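import Literature.NumberTheory.EllipticCurves.LocalReductionKrausTwo
import Literature.NumberTheory.EllipticCurves.ComplexMultiplicationLocalFactorsAux
import Literature.NumberTheory.EllipticCurves.CongruentNumberCurveSupersingular
import Literature.NumberTheory.EllipticCurves.QuadraticTwist
import Literature.NumberTheory.EllipticCurves.BSDRankZeroSieve
import Literature.NumberTheory.EllipticCurves.HeightFamily
import Literature.NumberTheory.DiophantineGeometry.ConductorRingOfIntegersProofs
import Literature.NumberTheory.DiophantineGeometry.ConductorFactorizationProofs
import Literature.NumberTheory.DiophantineGeometry.ConductorExponentZeroProofs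
import Literature.NumberTheory.DiophantineGeometry.ConductorMultiplicativeProofs
import Literature.NumberTheory.DiophantineGeometry.LocalReductionProofs
import HarnessLib

/-!
# The `2`-adic class of `y² + y = x³ − x`: good reduction at `2`, additive twist, odd conductor

Local arithmetic of the short Weierstrass curves `E_{A,B} : y² = x³ + Ax + B` in the `2`-adic class
`A ≡ −16`, `B ≡ 16 (mod 64)` of `E_{−16,16} ≅ 37a1` (`x = 4x'`, `y = 8y' + 4` gives
`y'² + y' = x'³ − x'`), with `4A³ + 27B²` squarefree away from `2` — the family on which
`BSDRankZeroGoodTwistFamily` realises Bhargava–Shankar's root-number equidistribution from the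
Modularity Theorem. Writing `A = 64k − 16`, `B = 64m + 16`:

* `4A³ + 27B² = 2⁸ d` with `d = 64(4k − 1)³ + 27(4m + 1)²` **odd**, `d ≡ 3 (mod 4)`
  (`negDisc_goodTwistClass`, `goodTwistD_odd`, `goodTwistD_mod_four`);
* `E_{A,B}` has **good reduction at `2`**: `⟨2, 0, 0, 4⟩ • E_{A,B}` is the `ℤ`-model
  `[0, 0, 1, 4k − 1, m]` of odd discriminant `−d` (`hasGoodReductionAt_two_goodTwistClass`;
  Silverman *AEC* VII.1 Rem. 1.1, VII.5 Prop. 5.1(a));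
* the twist `E_{A,−B} = E_{A,B}^{(−1)}` has **additive reduction at `2`**: `ord₂(Δ) = 12`,
  `c₆ = 2⁹ · 27(4m + 1)` with `27(4m + 1) ≡ 3 (mod 4)`, so Kraus's necessary condition excludes a
  good model (`not_hasGoodReductionAt_two_of_c₆_eq_512_mul` of `LocalReductionKrausTwo`; Kraus 1989,
  Prop. 2), and `ord₂(j) ≥ 0` excludes multiplicative reduction
  (`hasAdditiveReductionAt_two_negB_goodTwistClass`);
* at an odd prime `p`: good reduction if `p ∤ 4A³ + 27B²`, multiplicative if `p ∥ 4A³ + 27B²`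
  (then `p ≥ 5`, `p ∤ c₄ = −48A`; Silverman VII.5 Prop. 5.1(b)), so by Ogg–Silverman
  (`conductorExponent_eq_zero_iff`, `conductorExponent_eq_one_iff`, both proved in the tree) the
  **conductor is `N_{E_{A,B}} = |d|`**, odd, and `≡ 1 (mod 4)` when `4A³ + 27B² < 0`
  (`conductorNorm_goodTwistClass`, `conductorNorm_goodTwistClass_mod_four`).

Everything is proved; no definitions and no named facts are introduced (D-0026).

## References

* [SilvermanAEC2009] J. H. Silverman, *The Arithmetic of Elliptic Curves*, 2nd ed. (2009), VII.1
  Rem. 1.1, VII.5 Prop. 5.1, VIII.8; App. C §16 (conductor).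
* [Kraus1989] A. Kraus, *Quelques remarques à propos des invariants `c₄, c₆` et `Δ` d'une courbe
  elliptique*, Acta Arith. 54 (1989), Prop. 2.
* [Silverman1994] J. H. Silverman, *Advanced Topics in the Arithmetic of Elliptic Curves* (1994),
  IV.10.2 (`f_v = 0, 1` for good, multiplicative reduction).
-/

noncomputable section

open scoped Classical

open IsDedekindDomain WeierstrassCurve Rat.HeightOneSpectrum NumberField
open Literature.NumberTheory.EllipticCurves.RankZeroSieve

namespace Literature.NumberTheory.EllipticCurves

/-! ### Models and invariants -/

/-- `E_{A,B}` is the base change of the `ℤ`-model `[0, 0, 0, A, B]`. [folklore] -/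
theorem shortWeierstrass_eq_map (A B : ℤ) :
    shortWeierstrass (A, B) = (⟨0, 0, 0, A, B⟩ : WeierstrassCurve ℤ).map (Int.castRingHom ℚ) := by
  ext <;> simp [shortWeierstrass, WeierstrassCurve.map]

/-- **`E_{A,B}^{(−1)} = E_{A,−B}`**: the quadratic twist by `−1` of `y² = x³ + Ax + B` is
`y² = x³ + Ax − B` (`−y² = x³ + Ax + B`, `x ↦ −x`), on the nose for the tree's
`WeierstrassCurve.quadraticTwist`. [cite: BhargavaShankarTernary2015, §4.1 (arXiv v2), "the twist E₋₁ of E by −1"] -/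
theorem quadraticTwist_neg_one_shortWeierstrass (A B : ℤ) :
    (shortWeierstrass (A, B)).quadraticTwist (-1) = shortWeierstrass (A, -B) := by
  ext <;> simp [quadraticTwist, shortWeierstrass, b₂, b₄, b₆]
  ring

/-- Invariants of the `ℤ`-model `[0, 0, 0, A, B]`: `c₄ = −48A`, `c₆ = −864B`,
`Δ = −16(4A³ + 27B²)`. [cite: SilvermanAEC2009, III.1] -/
theorem shortModel_c₄_c₆_Δ (A B : ℤ) :
    (⟨0, 0, 0, A, B⟩ : WeierstrassCurve ℤ).c₄ = -48 * A ∧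
      (⟨0, 0, 0, A, B⟩ : WeierstrassCurve ℤ).c₆ = -864 * B ∧
        (⟨0, 0, 0, A, B⟩ : WeierstrassCurve ℤ).Δ = -16 * negDisc (A, B) := by
  refine ⟨?_, ?_, ?_⟩ <;> simp only [c₄, c₆, Δ, b₂, b₄, b₆, b₈, negDisc_apply] <;> ring

/-- `E_{A,B}` is elliptic iff `4A³ + 27B² ≠ 0`; here the forward direction we need. [folklore] -/
theorem isElliptic_shortWeierstrass_of_negDisc_ne_zero {A B : ℤ} (h : negDisc (A, B) ≠ 0) :
    (shortWeierstrass (A, B)).IsElliptic := by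
  refine ⟨isUnit_iff_ne_zero.mpr ?_⟩
  rw [shortWeierstrass_eq_map, map_Δ, (shortModel_c₄_c₆_Δ A B).2.2]
  simp only [eq_intCast, Int.cast_mul, Int.cast_neg, Int.cast_ofNat, ne_eq, mul_eq_zero,
    neg_eq_zero, OfNat.ofNat_ne_zero, Int.cast_eq_zero, false_or]
  exact h

/-! ### The `2`-adic class `A = 64k − 16`, `B = 64m + 16` -/

/-- `4A³ + 27B² = 2⁸ d`, `d = 64(4k − 1)³ + 27(4m + 1)²`, on the class. [folklore] -/
theorem negDisc_goodTwistClass (k m : ℤ) :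
    negDisc (64 * k - 16, 64 * m + 16) = 256 * (64 * (4 * k - 1) ^ 3 + 27 * (4 * m + 1) ^ 2) := by
  rw [negDisc_apply]; ring

/-- `negDisc (A, −B) = negDisc (A, B)`. [folklore] -/
theorem negDisc_neg (A B : ℤ) : negDisc (A, -B) = negDisc (A, B) := by
  simp only [negDisc_apply]; ring

/-- `d = 64(4k − 1)³ + 27(4m + 1)²` is odd. [folklore] -/
theorem goodTwistD_odd (k m : ℤ) : ¬ (2 : ℤ) ∣ 64 * (4 * k - 1) ^ 3 + 27 * (4 * m + 1) ^ 2 := by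
  rintro ⟨q, hq⟩
  have : (64 * (4 * k - 1) ^ 3 + 27 * (4 * m + 1) ^ 2 : ℤ) =
      2 * (2048 * k ^ 3 - 1536 * k ^ 2 + 384 * k + 216 * m ^ 2 + 108 * m - 19) + 1 := by ring
  omega

/-- `d ≡ 3 (mod 4)`. [folklore] -/
theorem goodTwistD_mod_four (k m : ℤ) :
    ∃ q : ℤ, 64 * (4 * k - 1) ^ 3 + 27 * (4 * m + 1) ^ 2 = 4 * q + 3 :=
  ⟨1024 * k ^ 3 - 768 * k ^ 2 + 192 * k + 108 * m ^ 2 + 54 * m - 10, by ring⟩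

/-- On the class, `4A³ + 27B² ≠ 0` (its odd part `d` is odd). [folklore] -/
theorem negDisc_goodTwistClass_ne_zero (k m : ℤ) : negDisc (64 * k - 16, 64 * m + 16) ≠ 0 := by
  rw [negDisc_goodTwistClass]
  intro h
  exact goodTwistD_odd k m ⟨0, by omega⟩

/-! ### Good reduction at `2` -/

section Two

variable (v : HeightOneSpectrum (𝓞 ℚ))

/-- **The good model at `2`**: `⟨2, 0, 0, 4⟩ • E_{A,B} = [0, 0, 1, 4k − 1, m]` for `A = 64k − 16`,
`B = 64m + 16` (`x = 4x'`, `y = 8y' + 4`). [cite: SilvermanAEC2009, III.1 Table 3.1] -/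
theorem smul_shortWeierstrass_goodTwistClass (k m : ℤ) :
    (⟨Units.mk0 2 two_ne_zero, 0, 0, 4⟩ : VariableChange ℚ) • shortWeierstrass (64 * k - 16, 64 * m + 16) =
      (⟨0, 0, 1, 4 * k - 1, m⟩ : WeierstrassCurve ℤ).map (Int.castRingHom ℚ) := by
  ext <;> simp only [variableChange_a₁, variableChange_a₂, variableChange_a₃, variableChange_a₄,
    variableChange_a₆, Units.val_inv_eq_inv_val, Units.val_mk0, shortWeierstrass, map_a₁, map_a₂,
    map_a₃, map_a₄, map_a₆, eq_intCast] <;> push_cast <;> field_simp <;> ring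

/-- The good model has odd discriminant `−d`. [folklore] -/
theorem goodModel_Δ (k m : ℤ) :
    (⟨0, 0, 1, 4 * k - 1, m⟩ : WeierstrassCurve ℤ).Δ = -(64 * (4 * k - 1) ^ 3 + 27 * (4 * m + 1) ^ 2) := by
  simp only [Δ, b₂, b₄, b₆, b₈]; ring

/-- **`E_{A,B}` has good reduction at `2`** on the class (the model `[0, 0, 1, 4k − 1, m]` is
`2`-integral with odd discriminant; Silverman VII.1 Rem. 1.1, VII.5 Prop. 5.1(a)).
[cite: SilvermanAEC2009, VII.1 Remark 1.1 and VII.5 Prop. 5.1(a)] -/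
theorem hasGoodReductionAt_two_goodTwistClass (hv : natGenerator v = 2) (k m : ℤ) :
    (shortWeierstrass (64 * k - 16, 64 * m + 16)).HasGoodReductionAt v := by
  have hodd : ¬ ((primesEquiv v : ℕ) : ℤ) ∣ (⟨0, 0, 1, 4 * k - 1, m⟩ : WeierstrassCurve ℤ).Δ := by
    rw [goodModel_Δ, dvd_neg, show ((primesEquiv v : ℕ) : ℤ) = (natGenerator v : ℤ) from rfl, hv]
    exact_mod_cast goodTwistD_odd k m
  have hg := hasGoodReductionAt_map_of_not_dvd _ v hodd
  rw [← smul_shortWeierstrass_goodTwistClass] at hg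
  exact (hasGoodReductionAt_smul_iff_holds v _ _).mp hg

/-- **`E_{A,−B}` has additive reduction at `2`** on the class: `ord₂(Δ) = 12`,
`c₆(E_{A,−B}) = 864B = 2⁹ · 27(4m + 1)` with `27(4m + 1) ≡ 3 (mod 4)`, so no good model exists by
Kraus's necessary condition (`not_hasGoodReductionAt_two_of_c₆_eq_512_mul`), while
`2⁸ ∣ c₄ = −48A` gives `|c₄|³ ≤ |Δ|`, excluding multiplicative reduction.
[cite: Kraus1989, Prop. 2] [cite: SilvermanAEC2009, VII.5 Prop. 5.1] -/
theorem hasAdditiveReductionAt_two_negB_goodTwistClass (hv : natGenerator v = 2) (k m : ℤ) :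
    (shortWeierstrass (64 * k - 16, -(64 * m + 16))).HasAdditiveReductionAt v := by
  set d : ℤ := 64 * (4 * k - 1) ^ 3 + 27 * (4 * m + 1) ^ 2 with hd
  set M : WeierstrassCurve ℤ := ⟨0, 0, 0, 64 * k - 16, -(64 * m + 16)⟩ with hM
  obtain ⟨hc₄, hc₆, hΔ⟩ := shortModel_c₄_c₆_Δ (64 * k - 16) (-(64 * m + 16))
  rw [shortWeierstrass_eq_map]
  have hdodd : ¬ (2 : ℤ) ∣ -d := by rw [dvd_neg]; exact goodTwistD_odd k m
  have hm : ¬ ((natGenerator v : ℕ) : ℤ) ∣ -d := by rw [hv]; exact_mod_cast hdodd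
  have hΔ' : M.Δ = (natGenerator v : ℤ) ^ 12 * (-d) := by
    rw [hΔ, negDisc_neg, negDisc_goodTwistClass, hv, hd]; push_cast; ring
  have hvΔ : v.valuation ℚ (M.map (Int.castRingHom ℚ)).Δ = WithZero.exp (-12 : ℤ) := by
    rw [map_Δ, eq_intCast, hΔ']
    push_cast
    have := Rat.valuation_pow_mul_intCast v hm 12
    push_cast at this
    exact this
  obtain ⟨q, hq⟩ := goodTwistD_mod_four k m
  have hng := not_hasGoodReductionAt_two_of_c₆_eq_512_mul v _ hv hvΔ (N := 27 * (4 * m + 1))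
    (by rw [map_c₆, eq_intCast, hc₆]; push_cast; ring) ⟨27 * m + 6, by ring⟩
  obtain ⟨h₁, h₂, h₃, h₄, h₆⟩ := valuation_map_a_le_one v M
  refine hasAdditiveReductionAt_of_not_hasGoodReductionAt_of_cube_le v _ h₁ h₂ h₃ h₄ h₆ hng ?_
  rw [map_Δ, map_c₄, eq_intCast, eq_intCast]
  refine Rat.valuation_cube_le_of_dvd v (e := 8) (n := 12) (m := -d) ?_ hΔ' hm (by norm_num)
  rw [hc₄, hv]; exact ⟨-12 * k + 3, by push_cast; ring⟩

/-- The same, for the twist `E_{A,B}^{(−1)}` at every place over `2` (the form of the hypothesis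
`hadd` of `QuadraticTwistNegOneLFunctionProofs`). [cite: Kraus1989, Prop. 2] -/
theorem hasAdditiveReductionAt_quadraticTwist_neg_one_goodTwistClass (k m : ℤ)
    (w : HeightOneSpectrum (𝓞 ℚ)) (hw : (primesEquiv w : ℕ) = 2) :
    ((shortWeierstrass (64 * k - 16, 64 * m + 16)).quadraticTwist (-1)).HasAdditiveReductionAt w := by
  rw [quadraticTwist_neg_one_shortWeierstrass]
  exact hasAdditiveReductionAt_two_negB_goodTwistClass w hw k m

end Two

/-! ### Odd places -/

section Odd

variable (v : HeightOneSpectrum (𝓞 ℚ)) {A B : ℤ}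

/-- `3 ∣ 4A³ + 27B²` forces `9 ∣ 4A³ + 27B²` (as `3 ∣ A`). [folklore] -/
theorem nine_dvd_negDisc_of_three_dvd (h : (3 : ℤ) ∣ negDisc (A, B)) : (9 : ℤ) ∣ negDisc (A, B) := by
  rw [negDisc_apply] at h ⊢
  have h3 : (3 : ℤ) ∣ 4 * A ^ 3 := by
    have h27 : (3 : ℤ) ∣ 27 * B ^ 2 := ⟨9 * B ^ 2, by ring⟩
    have := dvd_sub h h27
    rwa [add_sub_cancel_right] at this
  have hA : (3 : ℤ) ∣ A := by
    rcases Int.prime_three.dvd_or_dvd h3 with h | h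
    · norm_num at h
    · exact Int.prime_three.dvd_of_dvd_pow h
  obtain ⟨a, rfl⟩ := hA
  exact ⟨12 * a ^ 3 + 3 * B ^ 2, by ring⟩

/-- **Good reduction at an odd prime `p ∤ 4A³ + 27B²`** (the `ℤ`-model `[0, 0, 0, A, B]` has
`p`-unit discriminant `−16(4A³ + 27B²)`). [cite: SilvermanAEC2009, VII.5 Prop. 5.1(a)] -/
theorem hasGoodReductionAt_shortWeierstrass_of_not_dvd (hv2 : natGenerator v ≠ 2)
    (hD : ¬ (natGenerator v : ℤ) ∣ negDisc (A, B)) : (shortWeierstrass (A, B)).HasGoodReductionAt v := by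
  rw [shortWeierstrass_eq_map]
  refine hasGoodReductionAt_map_of_not_dvd _ v ?_
  rw [(shortModel_c₄_c₆_Δ A B).2.2, show ((primesEquiv v : ℕ) : ℤ) = (natGenerator v : ℤ) from rfl]
  intro h
  have hp := Rat.prime_natGenerator_int v
  rcases hp.dvd_or_dvd h with h16 | h'
  · have h2 : (natGenerator v : ℤ) ∣ 2 ^ 4 := by simpa using (dvd_neg.mp h16)
    have := hp.dvd_of_dvd_pow h2
    exact Rat.not_natGenerator_dvd_of_ne v Nat.prime_two hv2 (by exact_mod_cast this)
  · exact hD h'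

/-- **Multiplicative reduction at an odd prime `p ∥ 4A³ + 27B²`**: then `p ≠ 3` (as
`3 ∣ 4A³ + 27B² ⇒ 9 ∣ 4A³ + 27B²`), `p ∤ A` (else `p ∣ B` and `p² ∣ 4A³ + 27B²`), so `c₄ = −48A` is a
`p`-unit while `p ∣ Δ` (Silverman VII.5 Prop. 5.1(b), VII.1 Rem. 1.1).
[cite: SilvermanAEC2009, VII.5 Prop. 5.1(b) and VII.1 Remark 1.1] -/
theorem hasMultiplicativeReductionAt_shortWeierstrass_of_dvd (hv2 : natGenerator v ≠ 2)
    (hD : (natGenerator v : ℤ) ∣ negDisc (A, B)) (hD2 : ¬ (natGenerator v : ℤ) ^ 2 ∣ negDisc (A, B)) :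
    (shortWeierstrass (A, B)).HasMultiplicativeReductionAt v := by
  have hp := Rat.prime_natGenerator_int v
  have hpn : (natGenerator v).Prime := prime_natGenerator v
  have hne : negDisc (A, B) ≠ 0 := fun h ↦ hD2 (by rw [h]; exact dvd_zero _)
  haveI := isElliptic_shortWeierstrass_of_negDisc_ne_zero hne
  -- `p ≠ 3`
  have hv3 : natGenerator v ≠ 3 := by
    intro h3
    have hD' : (3 : ℤ) ∣ negDisc (A, B) := by rw [h3] at hD; exact_mod_cast hD
    have h9 := nine_dvd_negDisc_of_three_dvd hD'
    apply hD2
    rw [h3]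
    exact_mod_cast h9
  -- `p ∤ A`
  have hA : ¬ (natGenerator v : ℤ) ∣ A := by
    intro hA
    have h27 : (natGenerator v : ℤ) ∣ 27 * B ^ 2 := by
      have : (natGenerator v : ℤ) ∣ 4 * A ^ 3 := hA.trans ⟨4 * A ^ 2, by ring⟩
      have h' := dvd_sub hD this
      rw [negDisc_apply] at h'
      simpa using h'
    have hB : (natGenerator v : ℤ) ∣ B := by
      rcases hp.dvd_or_dvd h27 with h | h
      · have h33 : (natGenerator v : ℤ) ∣ 3 ^ 3 := by rw [show (3 : ℤ) ^ 3 = 27 by norm_num]; exact h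
        exact absurd (hp.dvd_of_dvd_pow h33) fun h3 ↦
          Rat.not_natGenerator_dvd_of_ne v Nat.prime_three hv3 (by exact_mod_cast h3)
      · exact hp.dvd_of_dvd_pow h
    apply hD2
    obtain ⟨a, rfl⟩ := hA
    obtain ⟨b, rfl⟩ := hB
    rw [negDisc_apply]
    exact ⟨4 * (natGenerator v : ℤ) * a ^ 3 + 27 * b ^ 2, by ring⟩
  -- `p ∤ 48`
  have h2' : ¬ (natGenerator v : ℤ) ∣ 2 := fun h ↦
    Rat.not_natGenerator_dvd_of_ne v Nat.prime_two hv2 (by exact_mod_cast h)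
  have h3' : ¬ (natGenerator v : ℤ) ∣ 3 := fun h ↦
    Rat.not_natGenerator_dvd_of_ne v Nat.prime_three hv3 (by exact_mod_cast h)
  have h48 : ¬ (natGenerator v : ℤ) ∣ 48 := by
    intro h
    have h' : (natGenerator v : ℤ) ∣ 2 ^ 4 * 3 := by rw [show (2 : ℤ) ^ 4 * 3 = 48 by norm_num]; exact h
    rcases hp.dvd_or_dvd h' with h | h
    · exact h2' (hp.dvd_of_dvd_pow h)
    · exact h3' h
  obtain ⟨hc₄, -, hΔ⟩ := shortModel_c₄_c₆_Δ A B
  rw [shortWeierstrass_eq_map]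
  obtain ⟨h₁, h₂, h₃, h₄, h₆⟩ := valuation_map_a_le_one v (⟨0, 0, 0, A, B⟩ : WeierstrassCurve ℤ)
  haveI : ((⟨0, 0, 0, A, B⟩ : WeierstrassCurve ℤ).map (Int.castRingHom ℚ)).IsElliptic := by
    rw [← shortWeierstrass_eq_map]; infer_instance
  refine hasMultiplicativeReductionAt_of_valuation_c₄_eq_one (isIntegralAt_of_valuation_le_one v _ h₁ h₂ h₃ h₄ h₆) ?_ ?_
  · rw [map_c₄, eq_intCast, hc₄]
    refine Literature.NumberTheory.GaloisRepresentations.Rat.valuation_intCast_eq_one v fun h ↦ ?_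
    rcases hp.dvd_or_dvd h with h | h
    · exact h48 (by rwa [dvd_neg] at h)
    · exact hA h
  · rw [map_Δ, eq_intCast, hΔ]
    have : (natGenerator v : ℤ) ^ 1 ∣ -16 * negDisc (A, B) := by
      rw [pow_one]; exact hD.trans (dvd_mul_left _ _)
    exact (Literature.NumberTheory.GaloisRepresentations.Rat.valuation_intCast_le v this).trans_lt
      (by rw [← WithZero.exp_zero]; exact WithZero.exp_lt_exp.mpr (by norm_num))

end Odd

/-! ### The conductor -/

section Conductor

/-- The conductor exponent of `W / ℚ` at the prime `p`, read at the place of `𝓞 ℚ` over `p`, is the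
exponent of `p` in `N_W` (`factorization_conductorNorm` over `ℤ` and the `𝓞 ℚ`-versus-`ℤ`
bridge `conductorExponent_eq_of_primesEquiv_eq`). [folklore] -/
theorem factorization_conductorNorm_eq_conductorExponent (W : WeierstrassCurve ℚ) [W.IsElliptic]
    (p : Nat.Primes) :
    (W.conductorNorm ℤ).factorization p =
      W.conductorExponent ((primesEquiv (R := 𝓞 ℚ)).symm p) := by
  have h1 := factorization_conductorNorm_holds W ((primesEquiv (R := ℤ)).symm p)
  rw [show natGenerator ((primesEquiv (R := ℤ)).symm p) = p from
    congrArg Subtype.val ((primesEquiv (R := ℤ)).apply_symm_apply p)] at h1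
  rw [h1]
  exact WeierstrassCurve.conductorExponent_eq_of_primesEquiv_eq _ _ W (by simp)

/-- The place of `𝓞 ℚ` over the prime `p` has `natGenerator = p`. [folklore] -/
theorem natGenerator_primesEquiv_symm_ringOfIntegers (p : Nat.Primes) :
    natGenerator ((primesEquiv (R := 𝓞 ℚ)).symm p) = p :=
  congrArg Subtype.val ((primesEquiv (R := 𝓞 ℚ)).apply_symm_apply p)

variable {A B : ℤ}

/-- **The conductor of `E_{A,B}` on the class is `|d|`**, `4A³ + 27B² = 2⁸ d`, when `4A³ + 27B²` is
squarefree away from `2`: `f₂ = 0` (good reduction at `2`), `f_p = 0` for odd `p ∤ d` (good),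
`f_p = 1` for odd `p ∣ d` (multiplicative), by Silverman *ATAEC* IV.10.2(a),(b)
(`conductorExponent_eq_zero_iff`, `conductorExponent_eq_one_iff`, proved in the tree), and
`N_E = ∏ p^{f_p}`. [cite: Silverman1994, IV.10.2(a),(b)] -/
theorem conductorNorm_goodTwistClass (k m : ℤ) (hsq : OddSqfree (64 * k - 16, 64 * m + 16)) :
    haveI := isElliptic_shortWeierstrass_of_negDisc_ne_zero (negDisc_goodTwistClass_ne_zero k m)
    (shortWeierstrass (64 * k - 16, 64 * m + 16)).conductorNorm ℤ =
      (64 * (4 * k - 1) ^ 3 + 27 * (4 * m + 1) ^ 2 : ℤ).natAbs := by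
  haveI := isElliptic_shortWeierstrass_of_negDisc_ne_zero (negDisc_goodTwistClass_ne_zero k m)
  set W := shortWeierstrass (64 * k - 16, 64 * m + 16) with hW
  set d : ℤ := 64 * (4 * k - 1) ^ 3 + 27 * (4 * m + 1) ^ 2 with hd
  have hdodd : ¬ (2 : ℤ) ∣ d := goodTwistD_odd k m
  have hd0 : d ≠ 0 := fun h ↦ hdodd (by rw [h]; exact dvd_zero _)
  have hD : negDisc (64 * k - 16, 64 * m + 16) = 256 * d := negDisc_goodTwistClass k m
  refine Nat.eq_of_factorization_eq (W.conductorNorm_pos_holds).ne' (Int.natAbs_ne_zero.mpr hd0)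
    fun p ↦ ?_
  by_cases hp : p.Prime
  swap
  · rw [Nat.factorization_eq_zero_of_not_prime _ hp, Nat.factorization_eq_zero_of_not_prime _ hp]
  set v : HeightOneSpectrum (𝓞 ℚ) := (primesEquiv (R := 𝓞 ℚ)).symm ⟨p, hp⟩ with hv
  have hvp : natGenerator v = p := natGenerator_primesEquiv_symm_ringOfIntegers ⟨p, hp⟩
  rw [factorization_conductorNorm_eq_conductorExponent W ⟨p, hp⟩]
  change W.conductorExponent v = _
  by_cases hp2 : p = 2
  · -- good reduction at `2`
    subst hp2
    rw [(conductorExponent_eq_zero_iff_holds v W).mpr (hasGoodReductionAt_two_goodTwistClass v hvp k m)]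
    rw [Nat.factorization_eq_zero_of_not_dvd]
    intro h
    exact hdodd (Int.dvd_natAbs.mp (by exact_mod_cast h))
  have hv2 : natGenerator v ≠ 2 := by rwa [hvp]
  by_cases hpd : (p : ℤ) ∣ d
  · -- multiplicative reduction: `f_p = 1`, `p ∥ d`
    have hpD : (natGenerator v : ℤ) ∣ negDisc (64 * k - 16, 64 * m + 16) := by
      rw [hD, hvp]; exact hpd.trans (dvd_mul_left _ _)
    have hpD2 : ¬ (natGenerator v : ℤ) ^ 2 ∣ negDisc (64 * k - 16, 64 * m + 16) := by
      rw [hvp]; exact hsq p hp hp2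
    rw [(conductorExponent_eq_one_iff_holds v W).mpr
      (hasMultiplicativeReductionAt_shortWeierstrass_of_dvd v hv2 hpD hpD2)]
    -- `p ∣ |d|`, `p² ∤ |d|`
    have h1 : p ∣ d.natAbs := by
      rw [← Int.natCast_dvd_natCast, Int.dvd_natAbs]; exact hpd
    have h2 : ¬ p ^ 2 ∣ d.natAbs := by
      intro h
      apply hpD2
      rw [hD, hvp]
      have : ((p : ℤ) ^ 2) ∣ d := by
        rw [← Int.dvd_natAbs]; exact_mod_cast h
      exact this.trans (dvd_mul_left _ _)
    have hle : 1 ≤ d.natAbs.factorization p :=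
      (hp.pow_dvd_iff_le_factorization (Int.natAbs_ne_zero.mpr hd0)).mp (by rwa [pow_one])
    have hlt : ¬ 2 ≤ d.natAbs.factorization p := fun h' ↦
      h2 ((hp.pow_dvd_iff_le_factorization (Int.natAbs_ne_zero.mpr hd0)).mpr h')
    omega
  · -- good reduction: `f_p = 0`, `p ∤ d`
    have hpD : ¬ (natGenerator v : ℤ) ∣ negDisc (64 * k - 16, 64 * m + 16) := by
      rw [hD, hvp]
      intro h
      rcases (Nat.prime_iff_prime_int.mp hp).dvd_or_dvd h with h | h
      · have : (p : ℤ) ∣ 2 ^ 8 := by norm_num at h ⊢; exact h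
        have := (Nat.prime_iff_prime_int.mp hp).dvd_of_dvd_pow this
        exact hp2 ((Nat.prime_dvd_prime_iff_eq hp Nat.prime_two).mp (by exact_mod_cast this))
      · exact hpd h
    rw [(conductorExponent_eq_zero_iff_holds v W).mpr
      (hasGoodReductionAt_shortWeierstrass_of_not_dvd v hv2 hpD)]
    rw [Nat.factorization_eq_zero_of_not_dvd]
    intro h
    exact hpd (Int.dvd_natAbs.mp (by exact_mod_cast h))

/-- **`N_{E_{A,B}} ≡ 1 (mod 4)` on the class when `4A³ + 27B² < 0`** (then `N = |d| = −d` with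
`d ≡ 3 (mod 4)`); in particular `N` is odd. [cite: Silverman1994, IV.10.2(a),(b)] -/
theorem conductorNorm_goodTwistClass_mod_four (k m : ℤ) (hsq : OddSqfree (64 * k - 16, 64 * m + 16))
    (hneg : negDisc (64 * k - 16, 64 * m + 16) < 0) :
    haveI := isElliptic_shortWeierstrass_of_negDisc_ne_zero (negDisc_goodTwistClass_ne_zero k m)
    (shortWeierstrass (64 * k - 16, 64 * m + 16)).conductorNorm ℤ % 4 = 1 := by
  rw [conductorNorm_goodTwistClass k m hsq]
  obtain ⟨q, hq⟩ := goodTwistD_mod_four k m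
  rw [negDisc_goodTwistClass] at hneg
  have hdneg : 64 * (4 * k - 1) ^ 3 + 27 * (4 * m + 1) ^ 2 < 0 := by linarith
  have h : ((64 * (4 * k - 1) ^ 3 + 27 * (4 * m + 1) ^ 2 : ℤ).natAbs : ℤ) = -(4 * q + 3) := by
    rw [Int.ofNat_natAbs_of_nonpos hdneg.le, hq]
  omega

end Conductor

end Literature.NumberTheory.EllipticCurves

end
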